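import Literature.AlgebraicGeometry.Motives.MixedHodgeStructureCatIndecomposableUniserial
import Literature.AlgebraicGeometry.Motives.MixedHodgeStructureCatCompositionMultiplicity
import Literature.AlgebraicGeometry.Motives.MixedHodgeStructureIndecomposableDual
import Literature.AlgebraicGeometry.Motives.MixedHodgeStructureSplitOverQTensor
import Literature.AlgebraicGeometry.Motives.MixedHodgeStructureMultiplicityDual
import Literature.AlgebraicGeometry.Motives.MixedHodgeStructureDualGradedPolarizable
import Literature.AlgebraicGeometry.Motives.MixedHodgeStructureLoewySeriesProd
import HarnessLib

/-!
# The dual object `X^∨ = of X.str.dual` in `MixedHodgeStructureCat`: transposes, the anti-isomorphism of subobject lattices, socle ∕ radical ∕ Loewy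
# duality and the invariants that `X ↦ X^∨` preserves

Layer `Literature/AlgebraicGeometry/Motives` (lane `lit-hodgefound`).  The tree's unbundled duality theory of finite-dimensional mixed Hodge structures
(`Motives/MixedHodgeStructureDual`: `H.dual` on `Module.Dual ℚ V` with `W_r(H^∨) = (W_{-r-1}H)^⊥` (Deligne 1.1.6–1.1.7), the transpose `f.transpose`;
`…Bidual`: `H ≅ H^∨∨`; `…DualSubobjects` ∕ `…SocleRadicalDuality` ∕ `…LoewySeries`: Fujiki's `S ↦ S^⊥`, `(rad H)^⊥ = soc(H^∨)`, `(socᵏH)^⊥ = radᵏ(H^∨)`;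
`…IndecomposableDual`, `…SplitOverQTensor`, `…Uniserial`, `…MultiplicityDual`, `…LengthFormulas`: invariance of simplicity, semisimplicity,
indecomposability, uniseriality, multiplicities, length) read in the CATEGORICAL vocabulary of this lane's dictionary (g43-#4 `subobjectEquiv`, g44-#16 ∕ #17,
g45-#2 ∕ #3 ∕ #5 ∕ #6) for the object `X^∨ := of X.str.dual` of `MixedHodgeStructureCat`:

* §1 `finite_dual`, the transpose as a morphism `transposeHom f : of Y.str.dual ⟶ of X.str.dual` (`_comp`, `_id`, `_zero`, `_add`), and
  **`mono_transposeHom_iff : Mono f^∨ ↔ Epi f`**, **`epi_transposeHom_iff`**, `isIso_transposeHom_iff`, `transposeHom_exact` (exactness reverses);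
* §2 **`subobjectDualOrderIso X : Subobject (of X.str.dual) ≃o (Subobject X)ᵒᵈ`** (`K ↦ K^⊥`, through `subobjectEquiv` on both sides and the tree's
  `annihilatorOrderIso`), with `coe_subobjectEquiv_subobjectDualOrderIso_symm` (the subobject of `X^∨` attached to `K` is the annihilator of `K`);
* §3 **`coe_subobjectEquiv_socle_dual : soc(X^∨) = (rad X)^⊥`**, **`coe_subobjectEquiv_radical_dual : rad(X^∨) = (soc X)^⊥`**, `…socleSeries_dual`,
  `…radicalSeries_dual` (Krause's series), **`height_dual`**, **`loewyLength_dual`**;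
* §4 invariance under `X ↦ X^∨`: `simple_dual_iff`, `isSemisimpleObj_dual_iff`, `indecomposable_dual_iff`, `isUniserial_dual_iff`, `length_dual`,
  **`compMult_dual : [X^∨ : T^∨] = [X : T]`**, `isPure_dual_iff` (`X^∨` pure of weight `-n` iff `X` pure of weight `n`), `isGradedPolarizable_dual_iff`.

Everything is PROVED; no named fact, no instance, no notation (data: the abbreviation `transposeHom` and the order isomorphism of §2).  The duality
FUNCTOR on the full subcategory of finite-dimensional objects is the object of a separate file.

Sources, verbatim (through the tree's files).  A. Fujiki, *Duality of mixed Hodge structures of algebraic varieties*, Publ. RIMS 16 (1980) [Fujiki1980],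
(1.6.2) a), b) (the dual MHS; the orthogonal of a mixed Hodge substructure is a mixed Hodge substructure).  P. Deligne, *Théorie de Hodge II* (1971)
[DeligneHodgeII1971], 1.1.6–1.1.7 (dual filtrations).  F. W. Anderson, K. R. Fuller, *Rings and Categories of Modules* (1992) [AndersonFuller1992], §32
Lemma 32.1 («(c) ⟹ (a) is dual to (d) ⟹ (a)»).  H. Krause, *Homological Theory of Representations* (2021) [Krause2021], Glossary «Socle», «Radical» (PDF p. 21).
E. Cattani, F. El Zein, P. A. Griffiths, Lê D. T. (eds.), *Hodge Theory* (2014) [CattaniElZeinGriffithsLe2014], Thm. 3.2.18, p. 270, Ex. 3.2.23 (2).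

## Main results

* §1 `finite_dual`, `transposeHom`, `transposeHom_toLinearMap`, `transposeHom_comp`, `transposeHom_id`, `transposeHom_zero`, `transposeHom_add`,
  **`mono_transposeHom_iff`**, **`epi_transposeHom_iff`**, `isIso_transposeHom_iff`, `transposeHom_exact`.
* §2 **`subobjectDualOrderIso`**, `subobjectDualOrderIso_apply`, `subobjectDualOrderIso_symm_apply`, `coe_subobjectEquiv_subobjectDualOrderIso_symm`.
* §3 **`coe_subobjectEquiv_socle_dual`**, **`coe_subobjectEquiv_radical_dual`**, `coe_subobjectEquiv_radicalSeries_dual`, `coe_subobjectEquiv_socleSeries_dual`,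
  **`height_dual`**, **`loewyLength_dual`**.
* §4 `simple_dual_iff`, `isSemisimpleObj_dual_iff`, `indecomposable_dual_iff`, `isUniserial_dual_iff`, `length_dual`, **`compMult_dual`**, `isPure_dual_iff`,
  `isGradedPolarizable_dual_iff`.

## References

* [Fujiki1980] A. Fujiki, Duality of mixed Hodge structures of algebraic varieties, Publ. RIMS Kyoto Univ. 16 (1980), (1.6.2).
* [DeligneHodgeII1971] P. Deligne, Théorie de Hodge II, Publ. Math. IHÉS 40 (1971), 1.1.6–1.1.7, 2.3.5.
* [AndersonFuller1992] F. W. Anderson, K. R. Fuller, Rings and Categories of Modules, 2nd ed., GTM 13 (1992), §32 Lemma 32.1.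
* [Krause2021] H. Krause, Homological Theory of Representations, Cambridge Stud. Adv. Math. 195 (2021), Glossary «Socle», «Radical» (PDF p. 21).
* [CattaniElZeinGriffithsLe2014] E. Cattani et al. (eds.), Hodge Theory, Princeton Math. Notes 49 (2014), Thm. 3.2.18, p. 270, Ex. 3.2.23 (2).

## Provenance

Lane `lit-hodgefound` (summit `HodgeConjecture`), seat `lit-hodgefound-p36` (literature-prover, generation 45, row g45-#9).
-/

noncomputable section

open CategoryTheory CategoryTheory.Limits

namespace Literature.AlgebraicGeometry.Motives

open Literature.CategoryTheory.KrullSchmidt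

universe u

namespace MixedHodgeStructureCat

/-! ## §1 The dual object and transposes -/

section Transpose

variable {X Y Z : MixedHodgeStructureCat.{u}} [Module.Finite ℚ X] [Module.Finite ℚ Y] [Module.Finite ℚ Z]

variable (X) in
/-- `X^∨` is finite-dimensional. [cite: Fujiki1980, (1.6.2) a)] -/
theorem finite_dual : Module.Finite ℚ (of X.str.dual) :=
  inferInstanceAs (Module.Finite ℚ (Module.Dual ℚ X))

/-- **The transpose `f^∨ : Y^∨ ⟶ X^∨`** of `f : X ⟶ Y`, as a morphism of `MixedHodgeStructureCat` (the tree's `Hom.transpose`). [cite: Fujiki1980, (1.6.2) a)]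
[cite: DeligneHodgeII1971, 1.1.6–1.1.7] -/
abbrev transposeHom (f : X ⟶ Y) : of Y.str.dual ⟶ of X.str.dual :=
  MixedHodgeStructure.Hom.transpose f

/-- On vectors `f^∨` is `Module.Dual`'s `dualMap` (precomposition). [cite: Fujiki1980, (1.6.2) a)] -/
theorem transposeHom_toLinearMap (f : X ⟶ Y) : (transposeHom f).toLinearMap = f.toLinearMap.dualMap :=
  MixedHodgeStructure.Hom.transpose_toLinearMap f

/-- `(f ≫ g)^∨ = g^∨ ≫ f^∨`. [cite: Fujiki1980, (1.6.2) a)] -/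
theorem transposeHom_comp (f : X ⟶ Y) (g : Y ⟶ Z) : transposeHom (f ≫ g) = transposeHom g ≫ transposeHom f :=
  MixedHodgeStructure.Hom.transpose_comp g f

variable (X) in
/-- `(𝟙 X)^∨ = 𝟙 X^∨`. [cite: Fujiki1980, (1.6.2) a)] -/
theorem transposeHom_id : transposeHom (𝟙 X) = 𝟙 (of X.str.dual) :=
  MixedHodgeStructure.Hom.transpose_id

/-- `0^∨ = 0`. [cite: Fujiki1980, (1.6.2) a)] -/
theorem transposeHom_zero : transposeHom (0 : X ⟶ Y) = 0 :=
  MixedHodgeStructure.Hom.transpose_zero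

/-- `(f + g)^∨ = f^∨ + g^∨`. [cite: Fujiki1980, (1.6.2) a)] -/
theorem transposeHom_add (f g : X ⟶ Y) : transposeHom (f + g) = transposeHom f + transposeHom g := by
  apply hom_ext
  rw [transposeHom_toLinearMap]
  change (f.toLinearMap + g.toLinearMap).dualMap = (transposeHom f).toLinearMap + (transposeHom g).toLinearMap
  rw [transposeHom_toLinearMap, transposeHom_toLinearMap]
  ext φ x
  simp only [LinearMap.dualMap_apply, LinearMap.add_apply, map_add]

/-- **`f^∨` is a monomorphism iff `f` is an epimorphism.** [cite: Fujiki1980, (1.6.2) a)] [cite: CattaniElZeinGriffithsLe2014, Thm. 3.2.18] -/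
theorem mono_transposeHom_iff (f : X ⟶ Y) : Mono (transposeHom f) ↔ Epi f := by
  rw [mono_iff_injective, epi_iff_surjective]
  exact MixedHodgeStructure.Hom.transpose_injective_iff f

/-- **`f^∨` is an epimorphism iff `f` is a monomorphism.** [cite: Fujiki1980, (1.6.2) a)] [cite: CattaniElZeinGriffithsLe2014, Thm. 3.2.18] -/
theorem epi_transposeHom_iff (f : X ⟶ Y) : Epi (transposeHom f) ↔ Mono f := by
  rw [mono_iff_injective, epi_iff_surjective]
  exact MixedHodgeStructure.Hom.transpose_surjective_iff f

/-- `f^∨` is an isomorphism iff `f` is. [cite: Fujiki1980, (1.6.2) a)] -/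
theorem isIso_transposeHom_iff (f : X ⟶ Y) : IsIso (transposeHom f) ↔ IsIso f := by
  rw [isIso_iff_bijective, isIso_iff_bijective]
  exact MixedHodgeStructure.Hom.transpose_bijective_iff f

/-- **Duality is exact** (reversing arrows): if `X ⟶ Y ⟶ Z` is exact then so is `Z^∨ ⟶ Y^∨ ⟶ X^∨`. [cite: Fujiki1980, (1.6.2) a)]
[cite: CattaniElZeinGriffithsLe2014, Thm. 3.2.18] -/
theorem transposeHom_exact (f : X ⟶ Y) (g : Y ⟶ Z) (w : f ≫ g = 0) (h : (ShortComplex.mk f g w).Exact) :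
    (ShortComplex.mk (transposeHom g) (transposeHom f) (by rw [← transposeHom_comp, w, transposeHom_zero])).Exact := by
  rw [exact_iff] at h ⊢
  exact MixedHodgeStructure.Hom.exact_transpose f g h

end Transpose

/-! ## §2 The subobjects of `X^∨` are the annihilators of the subobjects of `X` -/

section Lattice

variable (X : MixedHodgeStructureCat.{u}) [Module.Finite ℚ X]

/-- **`Subobject X^∨ ≃o (Subobject X)ᵒᵈ`**: `K' ↦ (K')_⊥`, inverse `K ↦ K^⊥` (Fujiki: `S ↦ S^⊥` is an anti-isomorphism of the lattices of sub-MHS; through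
`subobjectEquiv` on both sides). [cite: Fujiki1980, (1.6.2) b)] [cite: CattaniElZeinGriffithsLe2014, Thm. 3.2.18] -/
def subobjectDualOrderIso : Subobject (of X.str.dual) ≃o (Subobject X)ᵒᵈ :=
  (subobjectEquiv (of X.str.dual)).trans
    ((OrderIso.dualDual X.str.dual.subLattice).trans (X.str.annihilatorOrderIso.symm.dual.trans (subobjectEquiv X).symm.dual))

/-- Unfolding: `subobjectDualOrderIso X K'` is (the `OrderDual` of) the subobject `[(K')_⊥ ↪ X]` of the coannihilator.
[cite: Fujiki1980, (1.6.2) b)] -/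
theorem subobjectDualOrderIso_apply (K' : Subobject (of X.str.dual)) :
    OrderDual.ofDual (subobjectDualOrderIso X K') =
      ofSubMixedHodgeStructure X (MixedHodgeStructure.SubMixedHodgeStructure.ofElt (subobjectEquiv (of X.str.dual) K')).coannihilator := rfl

/-- Unfolding the inverse: `K ↦ [K^⊥ ↪ X^∨]`, the subobject of the annihilator. [cite: Fujiki1980, (1.6.2) b)] -/
theorem subobjectDualOrderIso_symm_apply (K : Subobject X) :
    (subobjectDualOrderIso X).symm (OrderDual.toDual K) =
      (subobjectEquiv (of X.str.dual)).symm (MixedHodgeStructure.SubMixedHodgeStructure.ofElt (subobjectEquiv X K)).annihilator.toElt := rfl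

/-- **The subobject of `X^∨` attached to `K ⊆ X` is the annihilator `K^⊥`**: its underlying subspace is `(im (K ↪ X)).dualAnnihilator`.
[cite: Fujiki1980, (1.6.2) b)] -/
theorem coe_subobjectEquiv_subobjectDualOrderIso_symm (K : Subobject X) :
    ((subobjectEquiv (of X.str.dual) ((subobjectDualOrderIso X).symm (OrderDual.toDual K)) : X.str.dual.subLattice) : Submodule ℚ (Module.Dual ℚ X)) =
      ((subobjectEquiv X K : X.str.subLattice) : Submodule ℚ X).dualAnnihilator := by
  rw [subobjectDualOrderIso_symm_apply, OrderIso.apply_symm_apply, MixedHodgeStructure.SubMixedHodgeStructure.coe_toElt,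
    MixedHodgeStructure.SubMixedHodgeStructure.annihilator_toSubmodule]
  rfl

end Lattice

/-! ## §3 Socle, radical and the Loewy series under duality -/

section Loewy

variable (X : MixedHodgeStructureCat.{u}) [Module.Finite ℚ X]

/-- **`soc(X^∨) = (rad X)^⊥`.** [cite: Fujiki1980, (1.6.2) b)] [cite: Krause2021, Glossary «Socle», «Radical» (PDF p. 21)] [cite: CattaniElZeinGriffithsLe2014, p. 270] -/
theorem coe_subobjectEquiv_socle_dual :
    haveI := isNoetherianObject_of_finite (of X.str.dual)
    haveI := isArtinianObject_of_finite X
    ((subobjectEquiv (of X.str.dual) (socle (of X.str.dual)) : X.str.dual.subLattice) : Submodule ℚ (Module.Dual ℚ X)) =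
      ((subobjectEquiv X (radical X) : X.str.subLattice) : Submodule ℚ X).dualAnnihilator := by
  haveI : HasFiniteBiproducts MixedHodgeStructureCat.{u} := hasFiniteBiproducts
  rw [coe_subobjectEquiv_socle, coe_subobjectEquiv_radical, ← MixedHodgeStructure.SubMixedHodgeStructure.annihilator_toSubmodule,
    MixedHodgeStructure.annihilator_radical]

/-- **`rad(X^∨) = (soc X)^⊥`.** [cite: Fujiki1980, (1.6.2) b)] [cite: Krause2021, Glossary «Socle», «Radical» (PDF p. 21)] [cite: CattaniElZeinGriffithsLe2014, p. 270] -/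
theorem coe_subobjectEquiv_radical_dual :
    haveI := isArtinianObject_of_finite (of X.str.dual)
    haveI := isNoetherianObject_of_finite X
    ((subobjectEquiv (of X.str.dual) (radical (of X.str.dual)) : X.str.dual.subLattice) : Submodule ℚ (Module.Dual ℚ X)) =
      ((subobjectEquiv X (socle X) : X.str.subLattice) : Submodule ℚ X).dualAnnihilator := by
  haveI : HasFiniteBiproducts MixedHodgeStructureCat.{u} := hasFiniteBiproducts
  rw [coe_subobjectEquiv_socle, coe_subobjectEquiv_radical, ← MixedHodgeStructure.SubMixedHodgeStructure.annihilator_toSubmodule,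
    MixedHodgeStructure.annihilator_socle]

/-- **`radᵏ(X^∨) = (socᵏ X)^⊥`** for Krause's series. [cite: Fujiki1980, (1.6.2) b)] [cite: Krause2021, Glossary «Socle», «Radical» (PDF p. 21)] -/
theorem coe_subobjectEquiv_radicalSeries_dual (k : ℕ) :
    haveI := isArtinianObject_of_finite (of X.str.dual)
    haveI := isNoetherianObject_of_finite X
    ((subobjectEquiv (of X.str.dual) (radicalSeries (of X.str.dual) k) : X.str.dual.subLattice) : Submodule ℚ (Module.Dual ℚ X)) =
      ((subobjectEquiv X (socleSeries X k) : X.str.subLattice) : Submodule ℚ X).dualAnnihilator := by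
  rw [coe_subobjectEquiv_socleSeries, coe_subobjectEquiv_radicalSeries, ← MixedHodgeStructure.SubMixedHodgeStructure.annihilator_toSubmodule,
    MixedHodgeStructure.annihilator_socleSeries]

/-- **`socᵏ(X^∨) = (radᵏ X)^⊥`.** [cite: Fujiki1980, (1.6.2) b)] [cite: Krause2021, Glossary «Socle», «Radical» (PDF p. 21)] -/
theorem coe_subobjectEquiv_socleSeries_dual (k : ℕ) :
    haveI := isNoetherianObject_of_finite (of X.str.dual)
    haveI := isArtinianObject_of_finite X
    ((subobjectEquiv (of X.str.dual) (socleSeries (of X.str.dual) k) : X.str.dual.subLattice) : Submodule ℚ (Module.Dual ℚ X)) =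
      ((subobjectEquiv X (radicalSeries X k) : X.str.subLattice) : Submodule ℚ X).dualAnnihilator := by
  -- `(socᵏ X^∨)_⊥ = i⁻¹(radᵏ X^∨∨) = radᵏ X`, then take annihilators
  have h : (MixedHodgeStructure.socleSeries X.str.dual k).coannihilator = MixedHodgeStructure.radicalSeries X.str k := by
    refine MixedHodgeStructure.SubMixedHodgeStructure.ext ?_
    change ((MixedHodgeStructure.socleSeries X.str.dual k).annihilator.comap (MixedHodgeStructure.Hom.bidual X.str)).toSubmodule = _
    rw [MixedHodgeStructure.SubMixedHodgeStructure.comap_toSubmodule, MixedHodgeStructure.annihilator_socleSeries,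
      MixedHodgeStructure.comap_radicalSeries_eq_of_bijective _ (MixedHodgeStructure.Hom.bidual_bijective X.str)]
  rw [coe_subobjectEquiv_socleSeries, coe_subobjectEquiv_radicalSeries, ← MixedHodgeStructure.SubMixedHodgeStructure.annihilator_toSubmodule, ← h,
    MixedHodgeStructure.SubMixedHodgeStructure.annihilator_coannihilator]

/-- **`ht(X^∨) = ht(X)`.** [cite: Krause2021, Glossary «Socle» (PDF p. 21)] [cite: Fujiki1980, (1.6.2) b)] -/
theorem height_dual :
    haveI := isNoetherianObject_of_finite (of X.str.dual)
    haveI := isNoetherianObject_of_finite X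
    height (of X.str.dual) = height X := by
  rw [height_eq_loewyLength_str, height_eq_loewyLength_str]
  exact MixedHodgeStructure.loewyLength_dual

/-- **`ℓℓ(X^∨) = ℓℓ(X)`.** [cite: Krause2021, Glossary «Radical» (PDF p. 21)] [cite: Fujiki1980, (1.6.2) b)] -/
theorem loewyLength_dual :
    haveI := isArtinianObject_of_finite (of X.str.dual)
    haveI := isArtinianObject_of_finite X
    loewyLength (of X.str.dual) = loewyLength X := by
  rw [loewyLength_eq_loewyLength_str, loewyLength_eq_loewyLength_str]
  exact MixedHodgeStructure.loewyLength_dual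

end Loewy

/-! ## §4 Invariants preserved by `X ↦ X^∨` -/

section Invariants

variable (X : MixedHodgeStructureCat.{u}) [Module.Finite ℚ X]

/-- `X^∨` is simple iff `X` is. [cite: Fujiki1980, (1.6.2)] [cite: CattaniElZeinGriffithsLe2014, Thm. 3.2.18] -/
theorem simple_dual_iff : Simple (of X.str.dual) ↔ Simple X := by
  rw [simple_iff_isSimple, simple_iff_isSimple]
  exact MixedHodgeStructure.isSimple_dual_iff

/-- `X^∨` is a semisimple object iff `X` is. [cite: Fujiki1980, (1.6.2)] [cite: CattaniElZeinGriffithsLe2014, Thm. 3.2.18] -/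
theorem isSemisimpleObj_dual_iff [HasFiniteBiproducts MixedHodgeStructureCat.{u}] : IsSemisimpleObj (of X.str.dual) ↔ IsSemisimpleObj X := by
  rw [isSemisimpleObj_iff_isSemisimple, isSemisimpleObj_iff_isSemisimple]
  exact MixedHodgeStructure.isSemisimple_dual_iff

/-- `X^∨` is indecomposable iff `X` is. [cite: Fujiki1980, (1.6.2)] [cite: Krause2021, Glossary «Indecomposable object» (PDF p. 21)] -/
theorem indecomposable_dual_iff : Indecomposable (of X.str.dual) ↔ Indecomposable X := by
  rw [indecomposable_iff_isIndecomposable, indecomposable_iff_isIndecomposable]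
  exact MixedHodgeStructure.isIndecomposable_dual_iff

/-- `X^∨` is uniserial iff `X` is. [cite: AndersonFuller1992, §32 Lemma 32.1] [cite: Fujiki1980, (1.6.2) b)] -/
theorem isUniserial_dual_iff : IsUniserial (of X.str.dual) ↔ IsUniserial X := by
  rw [isUniserial_iff_isUniserial, isUniserial_iff_isUniserial]
  exact MixedHodgeStructure.isUniserial_dual_iff

/-- **`ℓ(X^∨) = ℓ(X)`.** [cite: Fujiki1980, (1.6.2) b)] [cite: CattaniElZeinGriffithsLe2014, p. 270] -/
theorem length_dual : length (of X.str.dual) = length X := by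
  rw [length_eq_length, length_eq_length]
  exact congrArg _ (MixedHodgeStructure.length_dual X.str)

/-- **`[X^∨ : T^∨] = [X : T]`** for the categorical composition multiplicities. [cite: Fujiki1980, (1.6.2)] [cite: CattaniElZeinGriffithsLe2014, Thm. 3.2.18] -/
theorem compMult_dual (T : MixedHodgeStructureCat.{u}) [Module.Finite ℚ T] : compMult (of X.str.dual) (of T.str.dual) = compMult X T := by
  rw [compMult_eq_multiplicity, compMult_eq_multiplicity]
  exact MixedHodgeStructure.multiplicity_dual X.str T.str

/-- `X^∨` is pure of weight `-n` iff `X` is pure of weight `n`. [cite: DeligneHodgeII1971, 1.1.6–1.1.7] [cite: Fujiki1980, (1.6.2) a)] -/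
theorem isPure_dual_iff (n : ℤ) : isPure (-n) (of X.str.dual) ↔ isPure n X := by
  rw [isPure_iff, isPure_iff]
  exact MixedHodgeStructure.isPure_dual_iff X.str n

/-- `X^∨` is graded-polarizable iff `X` is. [cite: Fujiki1980, (1.6.2)] [cite: CattaniElZeinGriffithsLe2014, Def. 3.1.21] -/
theorem isGradedPolarizable_dual_iff : isGradedPolarizable (of X.str.dual) ↔ isGradedPolarizable X :=
  ⟨fun h => ⟨‹Module.Finite ℚ X›, (MixedHodgeStructure.isGradedPolarizable_dual_iff X.str).1 h.2⟩,
    fun h => ⟨finite_dual X, (MixedHodgeStructure.isGradedPolarizable_dual_iff X.str).2 h.2⟩⟩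

end Invariants

end MixedHodgeStructureCat

end Literature.AlgebraicGeometry.Motives

end
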